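import Summits.QuantumFields.YangMills.Theorems.UnitScaleTiltProp7TubeComparisonRowOfSkewRow
import HarnessLib

/-!
# Route `UnitScaleTilt`, crux «MinimiserStabilityRegPr» (stmt-QuantumFields-19200), stub `stub_existenceMinimalOrbit` (EX), pen (b1) —
# **THE ASSEMBLY DOOR OF THE TUBE-COMPARISON ROW: (iv) ⊕ DEFECT-bridge ⊕ LEG-sequel ⟹ the anti-Hermitian Frobenius row `hrow` of
# ✓`Prop7TubeComparisonRowOfSkewRow.tubeRowC_of_skewFrobRow` with `½CT = 2`**

Cell `ym3-torus`, twin-width seat `ym-ust-19200-w7` (gen 10).  THEOREMS ONLY (0 `def`, 0 `sorry`); `--supports stmt-QuantumFields-19200 --as helper`, count-neutral.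
YM₃ on T³ is ladder rung R3 — NOT d = 4, NOT infinite volume, NOT a mass gap, NOT Clay; nothing here claims a print row, the stub or the crux.

WHAT (★★OWNER WORD 52 book; holder w7).  The three remaining rows of pen (b1), DISPLAYED as binders over ABSTRACT coarse fields `S G : PBond (F.P K) (K−n) → M₂(ℂ)` and an
explicit unitary frame `Φ : PBond (F.P K) (K−n) → M₂(ℂ)ˣ` (no 19200∕20520 letters):
* (R1) = (iv) [routeR-w4 g25]: `Σ_c ‖T^{str}_{U₀}A(c) − ℓ^d • R(Φ c)(S c)‖_F² ≤ E₁·Σ_b‖A b‖_F²` (corner tree words vs framed stair means; `E₁ = C_T ε₀² ℓ^{d+2}` in print);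
* (R2) = DEFECT via the stair bridge [✓`Prop7TrueLinIterDefect` + bridge]: `Σ_c ‖S c − G c‖_F² ≤ E₂·Σ_b‖A b‖_F²`;
* (R3) = LEG ⊕ STRUCTURE ⊕ (v) [✓`QTwS_apply_eq_trueLinIter_sub_coarseGauge` + px13's ✓-pending `fderiv_frameAccU_eq_coarseGauge`, sequel]: `QTwS U₀ A c' = G (bondShift c')`;
CONCLUSION: `Σ_c‖T^{str}A(c)‖_F² ≤ 2(ℓ^d)²·Σ_{c'}‖QTwS U₀ A c'‖_F² + (4(ℓ^d)²E₂ + 4E₁)·Σ_b‖A b‖_F²` — i.e. `hrow` of ✓`tubeRowC_of_skewFrobRow` with `½CT = 2` and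
`½Cq ε₀² ℓ^dℓ² := 4(ℓ^d)²E₂ + 4E₁`.  Pure algebra: `‖a + b‖² ≤ 2‖a‖² + 2‖b‖²` twice, `‖R(Φ)M‖_F = ‖M‖_F` for unitary `Φ` (§1), reindexing `c' ↦ bondShift c'`.
[Balaban1984PropagatorsI] (1.18) p.20; [Balaban1985BackgroundPropagators] (3.13)–(3.15) p.393; [Balaban1985Averaging] (18)–(20) p.21, (56) p.27.
-/

set_option autoImplicit false

noncomputable section

open scoped BigOperators Matrix.Norms.L2Operator Matrix InnerProductSpace

namespace Summit.QuantumFields.YangMills.Theorems.Prop7SkewFrobRowAssembly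

open Literature.MathematicalPhysics.QuantumFieldTheory.Balaban1983to89
open Finset B1RG242Torus
open B7Prop1Explicit (treeWord)
open B7Prop2Explicit (unitaryUnits)
open B7Eq78Linearization (conjR conjR_apply)
open B10Eq27TorusAxialLog (holT unitsField toUField)
open T3ContinuumYM3Torus (T3Family)
open T3LevelShift (bondShift)
open T3PrintedRegularOrbits (sites_eq)
open Summit.QuantumFields.YangMills.Theorems.Prop7SectET3HilbertLetters (W₂ frobEquiv inner_frobEquiv_symm)
open Summit.QuantumFields.YangMills.Theorems.Prop7SymAvgTwSym (QTwS)

/-! ## §1 Frobenius norm: unitary conjugation invariance and the two-term split -/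

/-- `‖R(u)M‖_F = ‖M‖_F` for a unitary unit `u` (`tr((uMu⁻¹)ᴴ(uMu⁻¹)) = tr(MᴴM)`). [cite: Balaban1985Averaging, (56) p.27, (18) p.21] -/
theorem norm_frob_conjR_of_unitary {u : (Matrix (Fin 2) (Fin 2) ℂ)ˣ} (hu : u ∈ unitaryUnits (Matrix (Fin 2) (Fin 2) ℂ)) (M : Matrix (Fin 2) (Fin 2) ℂ) :
    ‖(frobEquiv.symm (conjR u M) : W₂)‖ = ‖(frobEquiv.symm M : W₂)‖ := by
  have hu' : ((u : (Matrix (Fin 2) (Fin 2) ℂ)ˣ) : Matrix (Fin 2) (Fin 2) ℂ) ∈ unitary (Matrix (Fin 2) (Fin 2) ℂ) := hu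
  have hinv : ((u⁻¹ : (Matrix (Fin 2) (Fin 2) ℂ)ˣ) : Matrix (Fin 2) (Fin 2) ℂ) = star (u : Matrix (Fin 2) (Fin 2) ℂ) :=
    Units.inv_eq_of_mul_eq_one_right (Unitary.mul_star_self_of_mem hu')
  have hsu : star (u : Matrix (Fin 2) (Fin 2) ℂ) * (u : Matrix (Fin 2) (Fin 2) ℂ) = 1 := Unitary.star_mul_self_of_mem hu'
  have hsq : ‖(frobEquiv.symm (conjR u M) : W₂)‖ ^ 2 = ‖(frobEquiv.symm M : W₂)‖ ^ 2 := by
    have h1 := inner_frobEquiv_symm (conjR u M) (conjR u M)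
    have h2 := inner_frobEquiv_symm M M
    rw [inner_self_eq_norm_sq_to_K] at h1 h2
    have key : Matrix.trace ((conjR u M).conjTranspose * conjR u M) = Matrix.trace (M.conjTranspose * M) := by
      have hsu' : (u : Matrix (Fin 2) (Fin 2) ℂ)ᴴ * (u : Matrix (Fin 2) (Fin 2) ℂ) = 1 := by rw [← Matrix.star_eq_conjTranspose]; exact hsu
      rw [conjR_apply, hinv, Matrix.star_eq_conjTranspose, Matrix.conjTranspose_mul, Matrix.conjTranspose_mul, Matrix.conjTranspose_conjTranspose]
      have e1 : (u : Matrix (Fin 2) (Fin 2) ℂ) * (Mᴴ * (u : Matrix (Fin 2) (Fin 2) ℂ)ᴴ) * ((u : Matrix (Fin 2) (Fin 2) ℂ) * M * (u : Matrix (Fin 2) (Fin 2) ℂ)ᴴ)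
          = (u : Matrix (Fin 2) (Fin 2) ℂ) * Mᴴ * ((u : Matrix (Fin 2) (Fin 2) ℂ)ᴴ * (u : Matrix (Fin 2) (Fin 2) ℂ)) * M * (u : Matrix (Fin 2) (Fin 2) ℂ)ᴴ := by
        noncomm_ring
      rw [e1, hsu', Matrix.mul_one, Matrix.trace_mul_cycle, ← Matrix.mul_assoc, hsu', Matrix.one_mul]
    have := h1.trans (key.trans h2.symm)
    exact_mod_cast this
  have h0 : 0 ≤ ‖(frobEquiv.symm (conjR u M) : W₂)‖ := norm_nonneg _
  have h0' : 0 ≤ ‖(frobEquiv.symm M : W₂)‖ := norm_nonneg _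
  nlinarith [hsq, h0, h0', sq_nonneg (‖(frobEquiv.symm (conjR u M) : W₂)‖ - ‖(frobEquiv.symm M : W₂)‖)]

/-- `‖a + b‖² ≤ 2‖a‖² + 2‖b‖²` in `W₂` (read through `frobEquiv⁻¹`). [cite: Balaban1985Averaging, (18)-(20) p.21] -/
theorem norm_sq_frob_add_le (a b : Matrix (Fin 2) (Fin 2) ℂ) :
    ‖(frobEquiv.symm (a + b) : W₂)‖ ^ 2 ≤ 2 * ‖(frobEquiv.symm a : W₂)‖ ^ 2 + 2 * ‖(frobEquiv.symm b : W₂)‖ ^ 2 := by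
  rw [map_add]
  have h := norm_add_le (frobEquiv.symm a : W₂) (frobEquiv.symm b)
  nlinarith [h, norm_nonneg (frobEquiv.symm a : W₂), norm_nonneg (frobEquiv.symm b : W₂), norm_nonneg ((frobEquiv.symm a : W₂) + frobEquiv.symm b),
    sq_nonneg (‖(frobEquiv.symm a : W₂)‖ - ‖(frobEquiv.symm b : W₂)‖)]

/-! ## §2 The assembly door -/

variable (F : T3Family) (n K : ℕ) (h : n ≤ K)

/-- ★★★ **THE ASSEMBLY DOOR OF PEN (b1)**: rows (R1) = (iv), (R2) = DEFECT via the stair bridge, (R3) = LEG-sequel, over abstract coarse fields `S, G` and an explicit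
unitary frame `Φ`, give the anti-Hermitian∕any-carrier Frobenius comparison `Σ_c‖T^{str}A(c)‖_F² ≤ 2(ℓ^d)²·Σ_{c'}‖QTwS U₀ A c'‖_F² + (4(ℓ^d)²E₂ + 4E₁)·Σ_b‖A b‖_F²`
(= `hrow` of ✓`Prop7TubeComparisonRowOfSkewRow.tubeRowC_of_skewFrobRow` with `½CT = 2`).  No estimate of print is used or proved here.
[cite: Balaban1984PropagatorsI, (1.18) p.20; Balaban1985BackgroundPropagators, (3.13)-(3.15) p.393; Balaban1985Averaging, (18)-(20) p.21] -/
theorem skewFrobRow_of_rows (U₀ : GaugeField (F.P K) 0 (Matrix.specialUnitaryGroup (Fin 2) ℂ)) (A : PBond (F.P K) 0 → Matrix (Fin 2) (Fin 2) ℂ)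
    (S G : PBond (F.P K) (K - n) → Matrix (Fin 2) (Fin 2) ℂ) (Φ : PBond (F.P K) (K - n) → (Matrix (Fin 2) (Fin 2) ℂ)ˣ)
    (hΦ : ∀ c, Φ c ∈ unitaryUnits (Matrix (Fin 2) (Fin 2) ℂ)) {E₁ E₂ : ℝ}
    -- (R1) = (iv): corner tree words vs framed stair means
    (hR1 : ∑ c : PBond (F.P K) (K - n), ‖(frobEquiv.symm ((∑ r : Fin (F.P K).d → Fin ((F.P K).L ^ (K - n)), ∑ t ∈ range ((F.P K).L ^ (K - n)),
        conjR (holT (unitsField (toUField U₀)) (Site.fibreSite 0 (K - n) c.src fun _ => ⟨0, pow_pos (F.P K).L_pos (K - n)⟩)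
              (treeWord fun ν => ((r ν : ℕ) : ℤ))
            * holT (unitsField (toUField U₀)) (Site.fibreSite 0 (K - n) c.src r) (List.replicate t (c.dir, true)))
          (A ⟨(fun z : Site (F.P K) 0 => z.shift c.dir)^[t] (Site.fibreSite 0 (K - n) c.src r), c.dir⟩))
        - ((((F.L : ℝ) ^ (K - n)) ^ (F.P K).d : ℝ) : ℂ) • conjR (Φ c) (S c)) : W₂)‖ ^ 2
      ≤ E₁ * ∑ b : PBond (F.P K) 0, ‖(frobEquiv.symm (A b) : W₂)‖ ^ 2)
    -- (R2) = DEFECT via the stair bridge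
    (hR2 : ∑ c : PBond (F.P K) (K - n), ‖(frobEquiv.symm (S c - G c) : W₂)‖ ^ 2 ≤ E₂ * ∑ b : PBond (F.P K) 0, ‖(frobEquiv.symm (A b) : W₂)‖ ^ 2)
    -- (R3) = LEG ⊕ STRUCTURE ⊕ coarse-gauge identity: the reduced true linearisation IS print's averaging operator
    (hR3 : ∀ c' : PBond (F.P n) 0, QTwS F n K h U₀ A c' = G (bondShift (sites_eq F n K h) c')) :
    ∑ c : PBond (F.P K) (K - n), ‖(frobEquiv.symm (∑ r : Fin (F.P K).d → Fin ((F.P K).L ^ (K - n)), ∑ t ∈ range ((F.P K).L ^ (K - n)),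
        conjR (holT (unitsField (toUField U₀)) (Site.fibreSite 0 (K - n) c.src fun _ => ⟨0, pow_pos (F.P K).L_pos (K - n)⟩)
              (treeWord fun ν => ((r ν : ℕ) : ℤ))
            * holT (unitsField (toUField U₀)) (Site.fibreSite 0 (K - n) c.src r) (List.replicate t (c.dir, true)))
          (A ⟨(fun z : Site (F.P K) 0 => z.shift c.dir)^[t] (Site.fibreSite 0 (K - n) c.src r), c.dir⟩)) : W₂)‖ ^ 2
      ≤ (2⁻¹ * 4 * (((F.L : ℝ) ^ (K - n)) ^ (F.P K).d) ^ 2) * ∑ c' : PBond (F.P n) 0, ‖(frobEquiv.symm (QTwS F n K h U₀ A c') : W₂)‖ ^ 2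
        + (4 * (((F.L : ℝ) ^ (K - n)) ^ (F.P K).d) ^ 2 * E₂ + 4 * E₁) * ∑ b : PBond (F.P K) 0, ‖(frobEquiv.symm (A b) : W₂)‖ ^ 2 := by
  classical
  -- letters
  set ld : ℝ := ((F.L : ℝ) ^ (K - n)) ^ (F.P K).d with hld
  set T : PBond (F.P K) (K - n) → Matrix (Fin 2) (Fin 2) ℂ := fun c =>
    ∑ r : Fin (F.P K).d → Fin ((F.P K).L ^ (K - n)), ∑ t ∈ range ((F.P K).L ^ (K - n)),
        conjR (holT (unitsField (toUField U₀)) (Site.fibreSite 0 (K - n) c.src fun _ => ⟨0, pow_pos (F.P K).L_pos (K - n)⟩)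
              (treeWord fun ν => ((r ν : ℕ) : ℤ))
            * holT (unitsField (toUField U₀)) (Site.fibreSite 0 (K - n) c.src r) (List.replicate t (c.dir, true)))
          (A ⟨(fun z : Site (F.P K) 0 => z.shift c.dir)^[t] (Site.fibreSite 0 (K - n) c.src r), c.dir⟩) with hTdef
  set NA : ℝ := ∑ b : PBond (F.P K) 0, ‖(frobEquiv.symm (A b) : W₂)‖ ^ 2 with hNA
  have hld0 : 0 ≤ ld := by
    rw [hld]
    have : (0 : ℝ) < F.L := by have := F.hL.2; exact_mod_cast (by omega : 0 < F.L)
    positivity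
  -- (R3) re-indexed: Σ_{c'} ‖QTwS A c'‖_F² = Σ_c ‖G c‖_F²
  have hG : ∑ c' : PBond (F.P n) 0, ‖(frobEquiv.symm (QTwS F n K h U₀ A c') : W₂)‖ ^ 2
      = ∑ c : PBond (F.P K) (K - n), ‖(frobEquiv.symm (G c) : W₂)‖ ^ 2 := by
    have hs := Equiv.sum_comp (bondShift (sites_eq F n K h)) (fun c => ‖(frobEquiv.symm (G c) : W₂)‖ ^ 2)
    refine Eq.trans (Finset.sum_congr rfl fun c' _ => ?_) hs
    rw [hR3 c']
  -- pointwise split: T c = ld•R(Φ c)(G c) + (ld•R(Φ c)(S c − G c) + (T c − ld•R(Φ c)(S c)))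
  have hpt : ∀ c : PBond (F.P K) (K - n),
      ‖(frobEquiv.symm (T c) : W₂)‖ ^ 2
        ≤ 2 * (ld ^ 2 * ‖(frobEquiv.symm (G c) : W₂)‖ ^ 2)
          + (4 * (ld ^ 2 * ‖(frobEquiv.symm (S c - G c) : W₂)‖ ^ 2) + 4 * ‖(frobEquiv.symm (T c - ((ld : ℝ) : ℂ) • conjR (Φ c) (S c)) : W₂)‖ ^ 2) := by
    intro c
    have hsplit : T c = ((ld : ℝ) : ℂ) • conjR (Φ c) (G c) + ((((ld : ℝ) : ℂ) • conjR (Φ c) (S c - G c)) + (T c - ((ld : ℝ) : ℂ) • conjR (Φ c) (S c))) := by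
      simp only [conjR_apply, Matrix.mul_sub, Matrix.sub_mul, smul_sub]
      abel
    -- norms of the scaled conjugated pieces
    have hn1 : ‖(frobEquiv.symm (((ld : ℝ) : ℂ) • conjR (Φ c) (G c)) : W₂)‖ ^ 2 = ld ^ 2 * ‖(frobEquiv.symm (G c) : W₂)‖ ^ 2 := by
      rw [map_smul, norm_smul, Complex.norm_real, Real.norm_of_nonneg hld0, mul_pow, norm_frob_conjR_of_unitary (hΦ c)]
    have hn2 : ‖(frobEquiv.symm (((ld : ℝ) : ℂ) • conjR (Φ c) (S c - G c)) : W₂)‖ ^ 2 = ld ^ 2 * ‖(frobEquiv.symm (S c - G c) : W₂)‖ ^ 2 := by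
      rw [map_smul, norm_smul, Complex.norm_real, Real.norm_of_nonneg hld0, mul_pow, norm_frob_conjR_of_unitary (hΦ c)]
    have h1 := norm_sq_frob_add_le (((ld : ℝ) : ℂ) • conjR (Φ c) (G c)) ((((ld : ℝ) : ℂ) • conjR (Φ c) (S c - G c)) + (T c - ((ld : ℝ) : ℂ) • conjR (Φ c) (S c)))
    have h2 := norm_sq_frob_add_le (((ld : ℝ) : ℂ) • conjR (Φ c) (S c - G c)) (T c - ((ld : ℝ) : ℂ) • conjR (Φ c) (S c))
    rw [← hsplit] at h1
    rw [hn1] at h1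
    rw [hn2] at h2
    linarith
  -- sum the pointwise split
  have hsum := Finset.sum_le_sum fun c (_ : c ∈ (Finset.univ : Finset (PBond (F.P K) (K - n)))) => hpt c
  rw [Finset.sum_add_distrib, Finset.sum_add_distrib, ← Finset.mul_sum, ← Finset.mul_sum, ← Finset.mul_sum, ← Finset.mul_sum, ← Finset.mul_sum] at hsum
  -- insert the rows
  rw [hG]
  have hE1 := hR1
  have hE2 := mul_le_mul_of_nonneg_left hR2 (by positivity : (0 : ℝ) ≤ 4 * ld ^ 2)
  have e : (2⁻¹ * 4 * ld ^ 2) = 2 * ld ^ 2 := by ring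
  rw [e]
  nlinarith [hsum, hE1, hE2, hld0]

/-- ★★ **THE ASSEMBLY DOOR WITH A MONOTONE SLACK** (reader's rider): any `β ≥ 4(ℓ^d)²E₂ + 4E₁` may stand in the slack term — in particular `β := ½Cq·ε₀²·ℓ^dℓ²` of
✓`Prop7TubeComparisonRowOfSkewRow.tubeRowC_of_skewFrobRow`'s `hrow` (`CT = 4`), the consumer's choice of `Cq`.
[cite: Balaban1984PropagatorsI, (1.18) p.20; Balaban1985BackgroundPropagators, (3.13)-(3.15) p.393] -/
theorem skewFrobRow_of_rows_of_le (U₀ : GaugeField (F.P K) 0 (Matrix.specialUnitaryGroup (Fin 2) ℂ)) (A : PBond (F.P K) 0 → Matrix (Fin 2) (Fin 2) ℂ)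
    (S G : PBond (F.P K) (K - n) → Matrix (Fin 2) (Fin 2) ℂ) (Φ : PBond (F.P K) (K - n) → (Matrix (Fin 2) (Fin 2) ℂ)ˣ)
    (hΦ : ∀ c, Φ c ∈ unitaryUnits (Matrix (Fin 2) (Fin 2) ℂ)) {E₁ E₂ β : ℝ}
    (hβ : 4 * (((F.L : ℝ) ^ (K - n)) ^ (F.P K).d) ^ 2 * E₂ + 4 * E₁ ≤ β)
    (hR1 : ∑ c : PBond (F.P K) (K - n), ‖(frobEquiv.symm ((∑ r : Fin (F.P K).d → Fin ((F.P K).L ^ (K - n)), ∑ t ∈ range ((F.P K).L ^ (K - n)),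
        conjR (holT (unitsField (toUField U₀)) (Site.fibreSite 0 (K - n) c.src fun _ => ⟨0, pow_pos (F.P K).L_pos (K - n)⟩)
              (treeWord fun ν => ((r ν : ℕ) : ℤ))
            * holT (unitsField (toUField U₀)) (Site.fibreSite 0 (K - n) c.src r) (List.replicate t (c.dir, true)))
          (A ⟨(fun z : Site (F.P K) 0 => z.shift c.dir)^[t] (Site.fibreSite 0 (K - n) c.src r), c.dir⟩))
        - ((((F.L : ℝ) ^ (K - n)) ^ (F.P K).d : ℝ) : ℂ) • conjR (Φ c) (S c)) : W₂)‖ ^ 2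
      ≤ E₁ * ∑ b : PBond (F.P K) 0, ‖(frobEquiv.symm (A b) : W₂)‖ ^ 2)
    (hR2 : ∑ c : PBond (F.P K) (K - n), ‖(frobEquiv.symm (S c - G c) : W₂)‖ ^ 2 ≤ E₂ * ∑ b : PBond (F.P K) 0, ‖(frobEquiv.symm (A b) : W₂)‖ ^ 2)
    (hR3 : ∀ c' : PBond (F.P n) 0, QTwS F n K h U₀ A c' = G (bondShift (sites_eq F n K h) c')) :
    ∑ c : PBond (F.P K) (K - n), ‖(frobEquiv.symm (∑ r : Fin (F.P K).d → Fin ((F.P K).L ^ (K - n)), ∑ t ∈ range ((F.P K).L ^ (K - n)),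
        conjR (holT (unitsField (toUField U₀)) (Site.fibreSite 0 (K - n) c.src fun _ => ⟨0, pow_pos (F.P K).L_pos (K - n)⟩)
              (treeWord fun ν => ((r ν : ℕ) : ℤ))
            * holT (unitsField (toUField U₀)) (Site.fibreSite 0 (K - n) c.src r) (List.replicate t (c.dir, true)))
          (A ⟨(fun z : Site (F.P K) 0 => z.shift c.dir)^[t] (Site.fibreSite 0 (K - n) c.src r), c.dir⟩)) : W₂)‖ ^ 2
      ≤ (2⁻¹ * 4 * (((F.L : ℝ) ^ (K - n)) ^ (F.P K).d) ^ 2) * ∑ c' : PBond (F.P n) 0, ‖(frobEquiv.symm (QTwS F n K h U₀ A c') : W₂)‖ ^ 2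
        + β * ∑ b : PBond (F.P K) 0, ‖(frobEquiv.symm (A b) : W₂)‖ ^ 2 := by
  have hmain := skewFrobRow_of_rows F n K h U₀ A S G Φ hΦ hR1 hR2 hR3
  have hNA : 0 ≤ ∑ b : PBond (F.P K) 0, ‖(frobEquiv.symm (A b) : W₂)‖ ^ 2 := by positivity
  have := mul_le_mul_of_nonneg_right hβ hNA
  linarith

end Summit.QuantumFields.YangMills.Theorems.Prop7SkewFrobRowAssembly

end
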